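import Literature.NumberTheory.Automorphic.ShintaniWhittakerFormula
import Literature.NumberTheory.Automorphic.CartanDecompositionGLnPowers
import HarnessLib

/-!
# Shintani's formula for a translated unramified Whittaker–Hecke datum (additive character of
arbitrary conductor)

Topic `NumberTheory/Automorphic`; namespace `Literature.NumberTheory.Automorphic`. Theorems only.
`ShintaniWhittakerFormula` evaluates an unramified Whittaker–Hecke datum `W` (`IsUnramifiedWhittakerDatum`:
`ψ`-equivariant under `U_n(F)`, right `GL_n(𝒪)`-invariant, Hecke eigen-sums with parameters `(s, x)`)
on the torus, `W(ϖ^μ) = s^{-b(μ)} s_μ(x) W(1)`, WHEN `ψ` has conductor `𝒪`. For a character of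
another conductor (e.g. the local component at `v ∣ 𝔡_K` of the standard adelic character, of
conductor `𝔡_v⁻¹`) one translates: for a diagonal `d = diag(d_i)` with constant ratios
`d_i / d_{i+1} = a`, the function `W_d(g) = W(d g)` is an unramified Whittaker–Hecke datum for the
character `ψ_a = ψ(a ·)` with the SAME parameters (`IsUnramifiedWhittakerDatum.diagonalGL_mul`:
`W(d u g) = W((d u d⁻¹) d g) = ψ_U(d u d⁻¹) W(d g) = (ψ_a)_U(u) W(d g)` by
`whittakerCharFun_diagonalGL_conj`; sphericity and the Hecke sums are right-translation statements).
Hence, if `ψ_a` has conductor `𝒪` — for `ψ` trivial on `a 𝒪` and non-trivial on `a ϖ⁻¹ 𝒪`, e.g.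
`a = ϖ^{-e}` for `ψ` of conductor `ϖ^{-e} 𝒪` — Shintani's formula and the vanishing off the antitone
cone hold for `W` along `d ϖ^μ` (`apply_diagonalGL_mul_piPowGL_eq_schur_mul`,
`apply_diagonalGL_mul_piPowGL_eq_zero_of_not_antitone`), and the standard choice
`d = t_e = diag(ϖ^{-e(n-1)}, …, ϖ^{-e}, 1)` has ratios `ϖ^{-e}` (`whittakerShift_ratio`), and a
non-trivial character trivial on `𝒪` has such a conductor exponent `e` (`AddChar.exists_shiftedConductor`). This is the classical remark that the unramified computation of
Jacquet–Shalika (1981), §2 / Cogdell (2004), Thm. 3.3 holds for every unramified `π_v` and every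
non-trivial `ψ_v`, up to the translation by `t_e` (Cogdell (2004), §3.1, footnote to Thm. 3.3:
"if `ψ_v` is not normalized, one must translate the essential vector").

## References

* T. Shintani, *On an explicit formula for class-1 "Whittaker functions" on `GL_n` over `𝔭`-adic
  fields*, Proc. Japan Acad. 52 (1976), Theorem (p. 181) [Shintani1976].
* J. W. Cogdell, *Analytic theory of L-functions for GL_n* (2004), §3.1, Thm. 3.3
  [CogdellAnalyticTheory2004].
-/

noncomputable section

namespace Literature.NumberTheory.Automorphic

open ValuativeRel Matrix Finset Literature.RingTheory.SymmetricFunctions.SymmPoly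

variable {F : Type*} [Field F] [ValuativeRel F] {n : ℕ}

section Datum

variable [Finite 𝓀[F]]

/-- **Translating an unramified Whittaker–Hecke datum by the torus.** If `W` is an unramified
Whittaker–Hecke datum for `ψ` with parameters `(s, x)` and `d = diag(d_i)` has constant ratios
`d_i d_{i+1}⁻¹ = a`, then `g ↦ W(d g)` is an unramified Whittaker–Hecke datum for `ψ_a = ψ(a ·)`
with the same parameters. [cite: CogdellAnalyticTheory2004, §3.1, Thm. 3.3] -/
theorem IsUnramifiedWhittakerDatum.diagonalGL_mul {ϖ : F} {hϖ : IsUniformizingElement ϖ}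
    {ψ : AddChar F Circle} {W : GL (Fin n) F → ℂ} {s : ℂ} {x : Fin n → ℂ}
    (h : IsUnramifiedWhittakerDatum hϖ ψ W s x) (d : Fin n → Fˣ) (a : Fˣ)
    (hd : ∀ i j : Fin n, (i : ℕ) + 1 = j → (d i : F) * ((d j)⁻¹ : Fˣ) = a) :
    IsUnramifiedWhittakerDatum hϖ (ψ.mulShift a) (fun g => W (diagonalGL (Fin n) F d * g)) s x where
  equivariant u g := by
    show W (diagonalGL (Fin n) F d * ((u : GL (Fin n) F) * g)) =
      whittakerCharFun (ψ.mulShift a) u * W (diagonalGL (Fin n) F d * g)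
    have hconj : diagonalGL (Fin n) F d * ((u : GL (Fin n) F) * g) =
        (diagonalGL (Fin n) F d * (u : GL (Fin n) F) * (diagonalGL (Fin n) F d)⁻¹) *
          (diagonalGL (Fin n) F d * g) := by group
    rw [hconj, ← whittakerCharFun_diagonalGL_conj ψ d a hd u]
    exact h.equivariant ⟨_, diagonalGL_conj_mem_upperUnitriangular d u.2⟩ _
  spherical k hk g := by
    show W (diagonalGL (Fin n) F d * (g * k)) = W (diagonalGL (Fin n) F d * g)
    rw [← mul_assoc, h.spherical k hk]
  hecke r hr1 hrn g := by
    show ∑ p : TransversalIndex n F r, W (diagonalGL (Fin n) F d * (g * p.rep hϖ.ne_zero)) =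
      s ^ (r * (n - r)) * esymm x r * W (diagonalGL (Fin n) F d * g)
    simp_rw [← mul_assoc]
    exact h.hecke r hr1 hrn _

/-- **Shintani's formula along a translated torus**: for `W`, `d`, `a` as in
`IsUnramifiedWhittakerDatum.diagonalGL_mul` with `ψ` trivial on `a 𝒪` and non-trivial on
`a ϖ⁻¹ 𝒪` (i.e. `ψ_a` of conductor `𝒪`), `s ≠ 0`, `s² = q` and antitone `μ`:
`W(d ϖ^μ) = s^{-b(μ)} s_μ(x) W(d)`. [cite: Shintani1976, Theorem (p. 181)]
[cite: CogdellAnalyticTheory2004, §3.1, Thm. 3.3] -/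
theorem apply_diagonalGL_mul_piPowGL_eq_schur_mul {ϖ : F} {hϖ : IsUniformizingElement ϖ}
    {ψ : AddChar F Circle} {W : GL (Fin n) F → ℂ} {s : ℂ} {x : Fin n → ℂ}
    (h : IsUnramifiedWhittakerDatum hϖ ψ W s x) (d : Fin n → Fˣ) (a : Fˣ)
    (hd : ∀ i j : Fin n, (i : ℕ) + 1 = j → (d i : F) * ((d j)⁻¹ : Fˣ) = a)
    (hψ : ∀ c ∈ 𝒪[F], ψ (a * c) = 1) (hψ' : ∃ c ∈ 𝒪[F], ψ (a * (ϖ⁻¹ * c)) ≠ 1) (hs : s ≠ 0)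
    (hq : ((Nat.card 𝓀[F] : ℕ) : ℂ) = s ^ 2) {mu : Fin n → ℕ} (hmu : Antitone mu) :
    W (diagonalGL (Fin n) F d * piPowGL hϖ.ne_zero mu) =
      s ^ (-torusExponent mu) * schur x mu * W (diagonalGL (Fin n) F d) := by
  have hψa : ∀ c ∈ 𝒪[F], ψ.mulShift a c = 1 := fun c hc => by
    rw [AddChar.mulShift_apply]; exact hψ c hc
  have hψa' : ∃ c ∈ 𝒪[F], ψ.mulShift a (ϖ⁻¹ * c) ≠ 1 := by
    obtain ⟨c, hc, hne⟩ := hψ'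
    exact ⟨c, hc, by rwa [AddChar.mulShift_apply]⟩
  have := apply_piPowGL_eq_schur_mul hψa hψa' (h.diagonalGL_mul d a hd) hs hq hmu
  simpa only [mul_one] using this

/-- **Vanishing off the antitone cone along a translated torus**: with `ψ` non-trivial on
`a ϖ⁻¹ 𝒪`, `W(d ϖ^ν) = 0` for non-antitone `ν`. [cite: Shintani1976, Theorem (p. 181)] -/
theorem apply_diagonalGL_mul_piPowGL_eq_zero_of_not_antitone {ϖ : F} {hϖ : IsUniformizingElement ϖ}
    {ψ : AddChar F Circle} {W : GL (Fin n) F → ℂ} {s : ℂ} {x : Fin n → ℂ}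
    (h : IsUnramifiedWhittakerDatum hϖ ψ W s x) (d : Fin n → Fˣ) (a : Fˣ)
    (hd : ∀ i j : Fin n, (i : ℕ) + 1 = j → (d i : F) * ((d j)⁻¹ : Fˣ) = a)
    (hψ' : ∃ c ∈ 𝒪[F], ψ (a * (ϖ⁻¹ * c)) ≠ 1) {nu : Fin n → ℕ} (hnu : ¬ Antitone nu) :
    W (diagonalGL (Fin n) F d * piPowGL hϖ.ne_zero nu) = 0 := by
  have hψa' : ∃ c ∈ 𝒪[F], ψ.mulShift a (ϖ⁻¹ * c) ≠ 1 := by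
    obtain ⟨c, hc, hne⟩ := hψ'
    exact ⟨c, hc, by rwa [AddChar.mulShift_apply]⟩
  have h' := h.diagonalGL_mul d a hd
  exact apply_piPowGL_eq_zero_of_not_antitone (W := fun g => W (diagonalGL (Fin n) F d * g)) hϖ hψa'
    h'.equivariant h'.spherical hnu

end Datum


/-! ### The shifted conductor of a character trivial on `𝒪` -/

section Conductor

/-- **The conductor exponent of a non-trivial character trivial on `𝒪`.** If `ψ` is trivial on `𝒪`
and non-trivial, there is `e ∈ ℕ` with `ψ` trivial on `ϖ^{-e} 𝒪` and non-trivial on `ϖ^{-e-1} 𝒪`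
(i.e. `ψ(ϖ^{-e} ·)` has conductor `𝒪`): the largest such `e`, which exists because every element of
`F` lies in some `ϖ^{-N} 𝒪`. For the local component at `v` of the standard adelic character this
`e` is `ord_v 𝔡_K` (not needed here). [folklore] -/
theorem AddChar.exists_shiftedConductor [IsDiscreteValuationRing 𝒪[F]] {ϖ : F} (hϖ : IsUniformizingElement ϖ)
    {ψ : AddChar F Circle} (hψ𝒪 : ∀ c ∈ 𝒪[F], ψ c = 1) (hψ : ψ ≠ 1) :
    ∃ e : ℕ, (∀ c ∈ 𝒪[F], ψ ((ϖ⁻¹) ^ e * c) = 1) ∧ ∃ c ∈ 𝒪[F], ψ ((ϖ⁻¹) ^ e * (ϖ⁻¹ * c)) ≠ 1 := by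
  classical
  -- some shift fails
  have hex : ∃ N : ℕ, ¬ ∀ c ∈ 𝒪[F], ψ ((ϖ⁻¹) ^ N * c) = 1 := by
    obtain ⟨x, hx⟩ := AddChar.ne_one_iff.1 hψ
    obtain ⟨N, hN⟩ := exists_pow_mul_mem hϖ x
    refine ⟨N, fun h => hx ?_⟩
    have := h (ϖ ^ N * x) (hN N le_rfl)
    rwa [← mul_assoc, inv_pow, inv_mul_cancel₀ (pow_ne_zero _ hϖ.ne_zero), one_mul] at this
  -- the least failing shift is positive; take its predecessor
  set m := Nat.find hex with hm
  have hm0 : m ≠ 0 := by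
    intro h0
    have h := Nat.find_spec hex
    rw [← hm, h0] at h
    exact h fun c hc => by rw [pow_zero, one_mul]; exact hψ𝒪 c hc
  obtain ⟨e, hme⟩ : ∃ e, m = e + 1 := ⟨m - 1, by omega⟩
  have he : ∀ c ∈ 𝒪[F], ψ ((ϖ⁻¹) ^ e * c) = 1 := by
    have := Nat.find_min hex (show e < Nat.find hex by rw [← hm]; omega)
    simpa only [not_not] using this
  refine ⟨e, he, ?_⟩
  have hfail : ¬ ∀ c ∈ 𝒪[F], ψ ((ϖ⁻¹) ^ (e + 1) * c) = 1 := by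
    have := Nat.find_spec hex
    rwa [← hm, hme] at this
  push Not at hfail
  obtain ⟨c, hc, hne⟩ := hfail
  exact ⟨c, hc, by rwa [← mul_assoc, ← pow_succ]⟩

end Conductor

/-! ### The Whittaker shift `t_e = diag(ϖ^{-e(n-1)}, …, ϖ^{-e}, 1)` -/

section Shift

omit [ValuativeRel F] in
/-- The **Whittaker shift** `t_e = diag(ϖ^{-e(n-1)}, …, ϖ^{-e}, 1)` (entries `ϖ^{-e(n-1-i)}`,
`0`-indexed, as the function `i ↦ (ϖ⁻¹)^{e(n-1-i)}`) has constant ratios `ϖ^{-e}`: conjugating `U_n` by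
`t_e` multiplies the superdiagonal by `ϖ^{-e}`, turning a character of conductor `ϖ^{-e}𝒪` into one of
conductor `𝒪`. [cite: CogdellAnalyticTheory2004, §3.1, Thm. 3.3] -/
theorem whittakerShift_ratio {ϖ : F} (hϖ : ϖ ≠ 0) (e : ℕ) (i j : Fin n) (hij : (i : ℕ) + 1 = j) :
    (((fun i : Fin n => (Units.mk0 ϖ hϖ)⁻¹ ^ (e * (n - 1 - (i : ℕ)))) i : Fˣ) : F) *
        (((fun i : Fin n => (Units.mk0 ϖ hϖ)⁻¹ ^ (e * (n - 1 - (i : ℕ)))) j)⁻¹ : Fˣ) =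
      ((Units.mk0 ϖ hϖ)⁻¹ ^ e : Fˣ) := by
  rw [← Units.val_mul]
  congr 1
  have hexp : e * (n - 1 - (i : ℕ)) = e * (n - 1 - (j : ℕ)) + e := by
    have := j.2
    rw [← mul_add_one]; congr 1; omega
  simp only [hexp, pow_add, mul_inv_cancel_comm]

omit [ValuativeRel F] in
/-- The last entry of the Whittaker shift `t_e` is `1` (so `e_n t_e = e_n`: translating by `t_e` does
not move the last row). [folklore] -/
theorem whittakerShift_last {ϖ : F} (hϖ : ϖ ≠ 0) (e : ℕ) (i : Fin n) (hi : (i : ℕ) + 1 = n) :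
    (fun i : Fin n => (Units.mk0 ϖ hϖ)⁻¹ ^ (e * (n - 1 - (i : ℕ)))) i = 1 := by
  have : n - 1 - (i : ℕ) = 0 := by omega
  simp only [this, mul_zero, pow_zero]

end Shift

end Literature.NumberTheory.Automorphic
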